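import Literature.AlgebraicGeometry.Resolution.SeparatingElementCriterion
import Literature.AlgebraicGeometry.Resolution.Kuhlmann2019HenselianRationalitySteps
import Literature.AlgebraicGeometry.Resolution.KnafKuhlmann2009Lemma21
import HarnessLib

/-!
# Kuhlmann 2019, Lemma 5.4 (separating elements with prescribed value and residue) — proof

Topic: `Literature/AlgebraicGeometry/Resolution` (valued function fields). DISCHARGE of the
named fact `Kuhlmann2019_Lemma54` (`Kuhlmann2019HenselianRationalitySteps.lean`) = F.-V.
Kuhlmann, *Elimination of ramification II: Henselian rationality*, Israel J. Math. 234 (2019) =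
arXiv:1701.05508, **Lemma 5.4**:

> Let `F|K` be a separable function field of transcendence degree 1 and `Q` a nontrivial place
> on `F`. Then for every `x ∈ F^×` there exists a separating element `y` of `F|K` which
> satisfies `v_Q(y) = v_Q(x)` and if `v_Q(x) = 0`, also `yQ = xQ`.
> *Proof.* Let us choose any separating element `z` of `F|K` and an element `a ∈ F^×` which
> satisfies `v_Q(a) > v_Q(x)` and `v_Q(az) > v_Q(x)`. … at least one of the elements
> `x, x+az, x+a` must be a separating element for the separable extension `K(x,x+az,x+a)|K`
> (cf. [24, VIII, §4, Proposition 4.8]); we take `y` to be such an element.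

We follow the printed idea — perturb `x` by elements of value `> v_Q(x)` until a separating
element is hit — with the perturbations taken in `K(z)` and the separating property decided by
the `K·F^p` criterion of `SeparatingElementCriterion.lean` (a transcendental `y ∈ F ∖ K·F^p` is
separating) in place of Mac Lane's theorem [24, VIII §4, Prop. 4.8]: in characteristic `p`, for
`z₁ ∈ {z, z⁻¹}` of value `≤ 1` and `t ∈ K(z)` of value smaller than `1` and than `v(x)` (such
`t` exist because `vF/vK(z)` is torsion), the three elements `wᵢ = z₁ (t^{i+1})^p` have value
`< v(x)` and pairwise differences `z₁ u^p`, `u ∈ K(z)^×`, which lie neither in `K·F^p`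
(`K(z) ∩ K·F^p = K(z^p) ∌ z₁`) nor in the algebraic closure of `K` (elements of `K(z) ∖ K` are
transcendental); since both `K·F^p` and the algebraic elements are closed under subtraction, at
most one `x + wᵢ` lies in `K·F^p` and at most one is algebraic, so some `y = x + wᵢ` is a
separating element with `v(y - x) = v(wᵢ) < v(x)`, i.e. `v(y) = v(x)` and `yQ = xQ` if
`v(x) = 0`. In characteristic `0` every transcendental `y ∈ F` is separating (the base `K(y)` is
perfect) and `wᵢ = (i+1)·w₀` for a `w₀ ∈ K(z) ∖ K` of small value does it.

## Content (PROVED)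

* `exists_separating_of_separablyGeneratedOver` — a separably generated `F|K` of transcendence
  degree `1` has a separating ELEMENT `z ∈ F` (a separating transcendence basis has one element:
  exchange property and algebraic independence).
* `exists_small_value_mem_closure` — elements of `K(z)` of value below `1` and below `v(x)`.
* `exists_good_index` — the pigeonhole step.
* `Kuhlmann2019_Lemma54_holds` — the discharge.

## Sources

* F.-V. Kuhlmann, Israel J. Math. 234 (2019) = arXiv:1701.05508, Lemma 5.4 (p. 13) and its
  proof. [folklore] for the field theory (Lang, *Algebra*, VIII §4).
-/

noncomputable section

open Polynomial

namespace Literature.AlgebraicGeometry.Resolution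

universe u

variable {Ω : Type u} [Field Ω]

/-! ### A separating element from a separating transcendence basis -/

section SeparatingElement

/-- **A separably generated `F|K` of transcendence degree `1` has a separating element `z ∈ F`**:
a separating transcendence basis `t ⊆ F` is non-empty (otherwise `F|K` would be algebraic) and
has at most one element (two of its elements would be algebraically dependent, both being
algebraic over `K(a)` for any transcendental `a ∈ F` by the exchange property). [folklore] -/
theorem exists_separating_of_separablyGeneratedOver {K F : Subfield Ω}
    (hsep : SeparablyGeneratedOver K F)
    (h1 : ∃ t₀ ∈ F, Transcendental K t₀ ∧
      ∀ z ∈ F, IsAlgebraic (IntermediateField.adjoin K ({t₀} : Set Ω)) z) :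
    ∃ z ∈ F, Transcendental K z ∧
      ∀ x ∈ F, IsSeparable (Subfield.closure ((K : Set Ω) ∪ {z})) x := by
  classical
  obtain ⟨t, htF, hind, hsept⟩ := hsep
  obtain ⟨t₀, ht₀F, ht₀, halg⟩ := h1
  -- `t` is non-empty
  have hne : t.Nonempty := by
    rw [Finset.nonempty_iff_ne_empty]
    rintro rfl
    apply ht₀
    have h := (hsept t₀ ht₀F).isIntegral.isAlgebraic
    rw [Finset.coe_empty, ← isAlgebraic_closure_iff] at h
    exact isAlgebraic_of_subfield_le
      (Subfield.closure_le.mpr (Set.union_subset (fun c hc => hc) (Set.empty_subset _))) h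
  obtain ⟨a, hat⟩ := hne
  have haF : a ∈ F := htF hat
  have hatr : Transcendental K a := hind.transcendental ⟨a, hat⟩
  -- every element of `F` is algebraic over `K(a)`
  have halga : ∀ b ∈ F, IsAlgebraic (IntermediateField.adjoin K ({a} : Set Ω)) b := by
    intro b hb
    have h₁ : IsAlgebraic (IntermediateField.adjoin K ({a} : Set Ω)) t₀ :=
      isAlgebraic_adjoin_swap hatr (halg a haF)
    rw [← isAlgebraic_closure_iff] at h₁ ⊢
    set Ka : Subfield Ω := Subfield.closure ((K : Set Ω) ∪ {a}) with hKa
    set Kat₀ : Subfield Ω := Subfield.closure ((Ka : Set Ω) ∪ {t₀}) with hKat₀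
    have hKKa : K ≤ Ka := fun c hc => Subfield.subset_closure (Or.inl hc)
    have hKaKat₀ : Ka ≤ Kat₀ := fun c hc => Subfield.subset_closure (Or.inl hc)
    have hKt₀_le : Subfield.closure ((K : Set Ω) ∪ {t₀}) ≤ Kat₀ :=
      Subfield.closure_mono (Set.union_subset_union_left _ hKKa)
    have hKat₀_alg : ∀ w ∈ Kat₀, IsAlgebraic Ka w := fun w hw =>
      isAlgebraic_of_mem_closure (fun u hu => by
        rw [Set.mem_singleton_iff] at hu
        rw [hu]
        exact h₁) hw
    exact isAlgebraic_trans_subfield hKaKat₀ hKat₀_alg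
      (isAlgebraic_of_subfield_le hKt₀_le ((isAlgebraic_closure_iff K {t₀} b).mpr (halg b hb)))
  -- hence `t = {a}`
  have ht1 : t = {a} := by
    refine Finset.eq_singleton_iff_unique_mem.mpr ⟨hat, fun b hbt => ?_⟩
    by_contra hne
    have hnot : (⟨b, hbt⟩ : ↥t) ∉ ({⟨a, hat⟩} : Set ↥t) := fun h => by
      rw [Set.mem_singleton_iff, Subtype.ext_iff] at h
      exact hne h
    have htr := hind.transcendental_adjoin hnot
    have himg : ((↑) : ↥t → Ω) '' ({⟨a, hat⟩} : Set ↥t) = {a} := by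
      rw [Set.image_singleton]
    rw [himg] at htr
    apply htr
    open scoped IntermediateField.algebraAdjoinAdjoin in
    exact (IsFractionRing.isAlgebraic_iff _ (IntermediateField.adjoin K ({a} : Set Ω)) Ω).mpr
      (halga b (htF hbt))
  refine ⟨a, haF, hatr, fun x hx => ?_⟩
  rw [isSeparable_closure_iff]
  have := hsept x hx
  rwa [ht1, Finset.coe_singleton] at this

/-- For `y ∈ F` transcendental over `K`, every element of `F` is algebraic over `K(y)` once it
is algebraic over `K(z)` for some `z` (exchange: `z` is algebraic over `K(y)`). [folklore] -/
theorem isAlgebraic_closure_of_transcendental {K F : Subfield Ω} {z : Ω}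
    (halg : ∀ b ∈ F, IsAlgebraic (Subfield.closure ((K : Set Ω) ∪ {z})) b) {y : Ω} (hyF : y ∈ F)
    (hyt : Transcendental K y) : ∀ b ∈ F, IsAlgebraic (Subfield.closure ((K : Set Ω) ∪ {y})) b := by
  set E : Subfield Ω := Subfield.closure ((K : Set Ω) ∪ {y}) with hE
  have hKE : K ≤ E := fun c hc => Subfield.subset_closure (Or.inl hc)
  have hzE : IsAlgebraic E z := by
    rw [hE, isAlgebraic_closure_iff]
    exact isAlgebraic_adjoin_swap hyt ((isAlgebraic_closure_iff K {z} y).mp (halg y hyF))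
  intro b hb
  set Ez : Subfield Ω := Subfield.closure ((E : Set Ω) ∪ {z}) with hEz
  have hEEz : E ≤ Ez := fun c hc => Subfield.subset_closure (Or.inl hc)
  have hKzEz : Subfield.closure ((K : Set Ω) ∪ {z}) ≤ Ez :=
    Subfield.closure_mono (Set.union_subset_union_left _ hKE)
  have hEz_alg : ∀ w ∈ Ez, IsAlgebraic E w := fun w hw =>
    isAlgebraic_of_mem_closure (fun u hu => by
      rw [Set.mem_singleton_iff] at hu
      rw [hu]
      exact hzE) hw
  exact isAlgebraic_trans_subfield hEEz hEz_alg (isAlgebraic_of_subfield_le hKzEz (halg b hb))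

end SeparatingElement

/-! ### Small values in `K(z)`; the pigeonhole step -/

section Values

variable (V : ValuationSubring Ω)

/-- **Elements of `K(z)` of value below `1` and below `v(x)`** (`F` algebraic over `K(z)`,
`v` non-trivial on `F`, `x ∈ F^×`): `vF/vK(z)` is torsion, so `vK(z)` contains a non-trivial
value and a power of `v(x)`. [folklore] -/
theorem exists_small_value_mem_closure {K F : Subfield Ω} {z : Ω}
    (halg : ∀ b ∈ F, IsAlgebraic (Subfield.closure ((K : Set Ω) ∪ {z})) b)
    (hnt : ∃ a ∈ F, a ≠ 0 ∧ V.valuation a ≠ 1) {x : Ω} (hxF : x ∈ F) (hx0 : x ≠ 0) :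
    ∃ t ∈ Subfield.closure ((K : Set Ω) ∪ {z}), t ≠ 0 ∧ V.valuation t < 1 ∧
      V.valuation t < V.valuation x := by
  set Kz : Subfield Ω := Subfield.closure ((K : Set Ω) ∪ {z}) with hKz
  obtain ⟨a, haF, ha0, ha1⟩ := hnt
  -- a non-trivial value in `vK(z)`
  obtain ⟨n, hn, b, hbKz, hab⟩ := exists_valuation_pow_eq_of_isAlgebraic V (halg a haF) ha0
  have hva : V.valuation a ≠ 0 := (_root_.map_ne_zero _).mpr ha0
  have hvb1 : V.valuation b ≠ 1 := by
    rw [← hab, map_pow]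
    intro h
    rcases lt_or_gt_of_ne ha1 with hlt | hgt
    · exact absurd h (pow_lt_one₀ zero_le hlt hn).ne
    · exact absurd h (one_lt_pow₀ hgt hn).ne'
  have hb0 : b ≠ 0 := by
    rintro rfl
    rw [map_zero] at hvb1 hab
    rw [map_pow, pow_eq_zero_iff hn] at hab
    exact hva hab
  obtain ⟨u, huKz, hu0, hu1⟩ : ∃ u ∈ Kz, u ≠ 0 ∧ V.valuation u < 1 := by
    rcases lt_or_gt_of_ne hvb1 with hlt | hgt
    · exact ⟨b, hbKz, hb0, hlt⟩
    · refine ⟨b⁻¹, Kz.inv_mem hbKz, inv_ne_zero hb0, ?_⟩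
      rw [map_inv₀]
      exact inv_lt_one_of_one_lt₀ hgt
  -- a power of `v(x)` in `vK(z)`
  obtain ⟨m, hm, s₀, hs₀Kz, hxs₀⟩ := exists_valuation_pow_eq_of_isAlgebraic V (halg x hxF) hx0
  have hvx : 0 < V.valuation x := (Valuation.pos_iff _).mpr hx0
  by_cases hx1 : V.valuation x < 1
  · refine ⟨s₀ ^ 2, Kz.pow_mem hs₀Kz 2, ?_, ?_, ?_⟩
    · intro h0
      rw [pow_eq_zero_iff two_ne_zero] at h0
      rw [h0, map_zero, map_pow, pow_eq_zero_iff hm] at hxs₀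
      exact hvx.ne' hxs₀
    · rw [map_pow, ← hxs₀, map_pow, ← pow_mul]
      exact pow_lt_one₀ zero_le hx1 (Nat.mul_ne_zero hm two_ne_zero)
    · rw [map_pow, ← hxs₀, map_pow, ← pow_mul]
      exact pow_lt_self_of_lt_one₀ hvx hx1 (by omega)
  · push Not at hx1
    exact ⟨u, huKz, hu0, hu1, lt_of_lt_of_le hu1 hx1⟩

variable {V}

/-- **The pigeonhole step**: if two "bad" properties `P`, `Q` are each closed under
subtraction and the pairwise differences of `w₀, w₁, w₂` are neither `P` nor `Q`, then some
`x + wᵢ` is neither `P` nor `Q` (at most one `x + wᵢ` is `P`, at most one is `Q`). [folklore] -/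
theorem exists_good_index {P Q : Ω → Prop} (hP : ∀ u v, P u → P v → P (u - v))
    (hQ : ∀ u v, Q u → Q v → Q (u - v)) (x : Ω) (w : Fin 3 → Ω)
    (hw : ∀ i j, i ≠ j → ¬ P (w i - w j) ∧ ¬ Q (w i - w j)) :
    ∃ i, ¬ P (x + w i) ∧ ¬ Q (x + w i) := by
  by_contra hcon
  push Not at hcon
  have key : ∀ i j, i ≠ j →
      ¬ (P (x + w i) ∧ P (x + w j)) ∧ ¬ (Q (x + w i) ∧ Q (x + w j)) := by
    intro i j hij
    obtain ⟨hp, hq⟩ := hw i j hij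
    have e : x + w i - (x + w j) = w i - w j := by ring
    exact ⟨fun h => hp (e ▸ hP _ _ h.1 h.2), fun h => hq (e ▸ hQ _ _ h.1 h.2)⟩
  rcases em (P (x + w 0)) with p0 | p0 <;> rcases em (P (x + w 1)) with p1 | p1 <;>
    rcases em (P (x + w 2)) with p2 | p2
  · exact (key 0 1 (by decide)).1 ⟨p0, p1⟩
  · exact (key 0 1 (by decide)).1 ⟨p0, p1⟩
  · exact (key 0 2 (by decide)).1 ⟨p0, p2⟩
  · exact (key 1 2 (by decide)).2 ⟨hcon 1 p1, hcon 2 p2⟩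
  · exact (key 1 2 (by decide)).1 ⟨p1, p2⟩
  · exact (key 0 2 (by decide)).2 ⟨hcon 0 p0, hcon 2 p2⟩
  · exact (key 0 1 (by decide)).2 ⟨hcon 0 p0, hcon 1 p1⟩
  · exact (key 0 1 (by decide)).2 ⟨hcon 0 p0, hcon 1 p1⟩

end Values

/-! ### The perturbation argument -/

section Perturb

variable (V : ValuationSubring Ω)

/-- **Characteristic `p`**: for a separating transcendental `z ∈ F` and `x ∈ F^×` there is a
separating element `y ∈ F` with `v(y - x) < v(x)` — some `y = x + z₁(t^{i+1})^p`, `i ≤ 2`, with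
`z₁ ∈ {z, z⁻¹}`, `t ∈ K(z)` of small value (module docstring). [cite: Kuhlmann2019, Lemma 5.4 (proof)] -/
theorem exists_separating_valuation_sub_lt_charP (p : ℕ) [Fact p.Prime] [CharP Ω p]
    {K F : Subfield Ω} (hKF : K ≤ F) (hfg : FGOver K F) {z : Ω} (hzF : z ∈ F)
    (hz : Transcendental K z)
    (hsepz : ∀ b ∈ F, IsSeparable (Subfield.closure ((K : Set Ω) ∪ {z})) b)
    (hnt : ∃ a ∈ F, a ≠ 0 ∧ V.valuation a ≠ 1) {x : Ω} (hxF : x ∈ F) (hx0 : x ≠ 0) :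
    ∃ y ∈ F, (∀ w ∈ F, IsSeparable (Subfield.closure ((K : Set Ω) ∪ {y})) w) ∧
      V.valuation (y - x) < V.valuation x := by
  classical
  have hp : (p : ℕ).Prime := Fact.out
  set Kz : Subfield Ω := Subfield.closure ((K : Set Ω) ∪ {z}) with hKz
  set Kzp : Subfield Ω := Subfield.closure ((K : Set Ω) ∪ {z ^ p}) with hKzp
  set KFp : Subfield Ω := Subfield.closure ((K : Set Ω) ∪ frobenius Ω p '' (F : Set Ω)) with hKFp
  have hKKz : K ≤ Kz := fun c hc => Subfield.subset_closure (Or.inl hc)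
  have hKKzp : K ≤ Kzp := fun c hc => Subfield.subset_closure (Or.inl hc)
  have hzKz : z ∈ Kz := Subfield.subset_closure (Or.inr rfl)
  have hKzF : Kz ≤ F := Subfield.closure_le.mpr (Set.union_subset hKF (Set.singleton_subset_iff.mpr hzF))
  have halg : ∀ b ∈ F, IsAlgebraic Kz b := fun b hb => (hsepz b hb).isIntegral.isAlgebraic
  have hz0 : z ≠ 0 := fun h0 => hz (h0 ▸ isAlgebraic_zero)
  -- `t ∈ K(z)` of value `< 1` and `< v(x)`; `z₁ ∈ {z, z⁻¹}` of value `≤ 1`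
  obtain ⟨t, htKz, ht0, ht1, htx⟩ := exists_small_value_mem_closure V halg hnt hxF hx0
  have hvt0 : 0 < V.valuation t := (Valuation.pos_iff _).mpr ht0
  obtain ⟨z₁, hz₁Kz, hz₁0, hz₁v, hz₁np⟩ :
      ∃ z₁ ∈ Kz, z₁ ≠ 0 ∧ V.valuation z₁ ≤ 1 ∧ z₁ ∉ Kzp := by
    have hznp : z ∉ Kzp := not_mem_closure_pow_of_transcendental K hp.one_lt hz
    by_cases hvz : V.valuation z ≤ 1
    · exact ⟨z, hzKz, hz0, hvz, hznp⟩
    · refine ⟨z⁻¹, Kz.inv_mem hzKz, inv_ne_zero hz0, ?_, fun h => hznp ?_⟩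
      · rw [map_inv₀]
        exact inv_le_one_of_one_le₀ (not_le.mp hvz).le
      · simpa using Kzp.inv_mem h
  -- the perturbations `wᵢ = z₁ (t^{i+1})^p`
  set w : Fin 3 → Ω := fun i => z₁ * (t ^ (i.val + 1)) ^ p with hw
  have hwKz : ∀ i, w i ∈ Kz := fun i => Kz.mul_mem hz₁Kz (Kz.pow_mem (Kz.pow_mem htKz _) _)
  have hwval : ∀ i, V.valuation (w i) < V.valuation x := fun i => by
    rw [hw, map_mul, map_pow, map_pow, ← pow_mul]
    calc V.valuation z₁ * V.valuation t ^ ((i.val + 1) * p)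
        ≤ 1 * V.valuation t ^ ((i.val + 1) * p) := mul_le_mul' hz₁v le_rfl
      _ = V.valuation t ^ ((i.val + 1) * p) := one_mul _
      _ ≤ V.valuation t := pow_le_of_le_one zero_le ht1.le (Nat.mul_ne_zero (by omega) hp.ne_zero)
      _ < V.valuation x := htx
  -- pairwise differences `z₁ u^p`, `u = t^{i+1} - t^{j+1} ≠ 0`
  have hdiff : ∀ i j, i ≠ j → ∃ u ∈ Kz, u ≠ 0 ∧ w i - w j = z₁ * u ^ p := by
    intro i j hij
    refine ⟨t ^ (i.val + 1) - t ^ (j.val + 1), Kz.sub_mem (Kz.pow_mem htKz _) (Kz.pow_mem htKz _),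
      fun h0 => ?_, ?_⟩
    · have heq : t ^ (i.val + 1) = t ^ (j.val + 1) := sub_eq_zero.mp h0
      have hinj := (pow_right_strictAnti₀ hvt0 ht1).injective
        (show V.valuation t ^ (i.val + 1) = V.valuation t ^ (j.val + 1) by
          rw [← map_pow, ← map_pow, heq])
      exact hij (Fin.ext (by simpa using hinj))
    · rw [hw, ← mul_sub, sub_pow_char]
  have hnotKzp : ∀ u ∈ Kz, u ≠ 0 → z₁ * u ^ p ∉ Kzp := fun u huKz hu0 hmem => by
    have hup : u ^ p ∈ Kzp := pow_mem_closure_pow p K z huKz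
    have hup0 : u ^ p ≠ 0 := pow_ne_zero _ hu0
    have : z₁ = z₁ * u ^ p * (u ^ p)⁻¹ := by rw [mul_assoc, mul_inv_cancel₀ hup0, mul_one]
    exact hz₁np (this ▸ Kzp.mul_mem hmem (Kzp.inv_mem hup))
  -- the pigeonhole step with `P = (· ∈ K·F^p)`, `Q = algebraic over K`
  obtain ⟨i, hiP, hiQ⟩ := exists_good_index (P := fun u => u ∈ KFp) (Q := fun u => IsAlgebraic K u)
    (fun u v hu hv => KFp.sub_mem hu hv) (fun u v hu hv => hu.sub hv) x w (fun i j hij => by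
      obtain ⟨u, huKz, hu0, hwu⟩ := hdiff i j hij
      have hmemKz : z₁ * u ^ p ∈ Kz := Kz.mul_mem hz₁Kz (Kz.pow_mem huKz _)
      rw [hwu]
      refine ⟨fun hmem => hnotKzp u huKz hu0 (mem_closure_pow_of_mem_compositumPow hsepz hmemKz hmem),
        fun halgK => ?_⟩
      exact transcendental_of_mem_closure K hz hmemKz
        (fun hK => hnotKzp u huKz hu0 (hKKzp hK)) halgK)
  -- `y = x + wᵢ`
  have hyF : x + w i ∈ F := F.add_mem hxF (hKzF (hwKz i))
  refine ⟨x + w i, hyF, ?_, ?_⟩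
  · exact isSeparable_adjoin_of_not_mem_compositumPow p hKF hfg hz hzF hsepz hyF hiQ hiP
  · rw [add_sub_cancel_left]
    exact hwval i

/-- **Characteristic `0`**: for a transcendental `z ∈ F` over which `F` is algebraic and
`x ∈ F^×` there is a transcendental `y ∈ F`, over `K(y)` of which `F` is separable algebraic,
with `v(y - x) < v(x)` — some `y = x + (i+1)·w₀`, `i ≤ 2`, for `w₀ ∈ K(z) ∖ K` of small value.
[cite: Kuhlmann2019, Lemma 5.4 (proof)] -/
theorem exists_separating_valuation_sub_lt_charZero [CharZero Ω]
    {K F : Subfield Ω} (hKF : K ≤ F) {z : Ω} (hzF : z ∈ F) (hz : Transcendental K z)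
    (halg : ∀ b ∈ F, IsAlgebraic (Subfield.closure ((K : Set Ω) ∪ {z})) b)
    (hnt : ∃ a ∈ F, a ≠ 0 ∧ V.valuation a ≠ 1) {x : Ω} (hxF : x ∈ F) (hx0 : x ≠ 0) :
    ∃ y ∈ F, (∀ w ∈ F, IsSeparable (Subfield.closure ((K : Set Ω) ∪ {y})) w) ∧
      V.valuation (y - x) < V.valuation x := by
  classical
  set Kz : Subfield Ω := Subfield.closure ((K : Set Ω) ∪ {z}) with hKz
  have hKKz : K ≤ Kz := fun c hc => Subfield.subset_closure (Or.inl hc)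
  have hzKz : z ∈ Kz := Subfield.subset_closure (Or.inr rfl)
  have hKzF : Kz ≤ F := Subfield.closure_le.mpr (Set.union_subset hKF (Set.singleton_subset_iff.mpr hzF))
  have hz0 : z ≠ 0 := fun h0 => hz (h0 ▸ isAlgebraic_zero)
  have hzK : z ∉ K := fun h => hz (isAlgebraic_algebraMap (⟨z, h⟩ : K))
  obtain ⟨t, htKz, ht0, ht1, htx⟩ := exists_small_value_mem_closure V halg hnt hxF hx0
  -- `z₁ ∈ {z, z⁻¹}` of value `≤ 1`, not in `K`
  obtain ⟨z₁, hz₁Kz, hz₁0, hz₁v, hz₁K⟩ : ∃ z₁ ∈ Kz, z₁ ≠ 0 ∧ V.valuation z₁ ≤ 1 ∧ z₁ ∉ K := by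
    by_cases hvz : V.valuation z ≤ 1
    · exact ⟨z, hzKz, hz0, hvz, hzK⟩
    · refine ⟨z⁻¹, Kz.inv_mem hzKz, inv_ne_zero hz0, ?_, fun h => hzK ?_⟩
      · rw [map_inv₀]
        exact inv_le_one_of_one_le₀ (not_le.mp hvz).le
      · simpa using K.inv_mem h
  -- `w₀ ∈ {z₁ t, z₁ t²}` not in `K`, of value `< v(x)`
  obtain ⟨w₀, hw₀Kz, hw₀K, hw₀val⟩ : ∃ w₀ ∈ Kz, w₀ ∉ K ∧ V.valuation w₀ < V.valuation x := by
    have hv1 : V.valuation (z₁ * t) < V.valuation x := by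
      rw [map_mul]
      calc V.valuation z₁ * V.valuation t ≤ 1 * V.valuation t := mul_le_mul' hz₁v le_rfl
        _ = V.valuation t := one_mul _
        _ < V.valuation x := htx
    have hv2 : V.valuation (z₁ * t ^ 2) < V.valuation x := by
      rw [map_mul, map_pow]
      calc V.valuation z₁ * V.valuation t ^ 2 ≤ 1 * V.valuation t ^ 2 := mul_le_mul' hz₁v le_rfl
        _ = V.valuation t ^ 2 := one_mul _
        _ ≤ V.valuation t := pow_le_of_le_one zero_le ht1.le two_ne_zero
        _ < V.valuation x := htx
    by_cases h1 : z₁ * t ∈ K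
    · refine ⟨z₁ * t ^ 2, Kz.mul_mem hz₁Kz (Kz.pow_mem htKz 2), fun h2 => hz₁K ?_, hv2⟩
      -- `t = (z₁ t²)/(z₁ t) ∈ K`, `z₁ = (z₁ t)/t ∈ K`
      have hzt0 : z₁ * t ≠ 0 := mul_ne_zero hz₁0 ht0
      have htK : t ∈ K := by
        have : t = z₁ * t ^ 2 * (z₁ * t)⁻¹ := by
          rw [eq_mul_inv_iff_mul_eq₀ hzt0]
          ring
        exact this ▸ K.mul_mem h2 (K.inv_mem h1)
      have : z₁ = z₁ * t * t⁻¹ := by rw [mul_assoc, mul_inv_cancel₀ ht0, mul_one]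
      exact this ▸ K.mul_mem h1 (K.inv_mem htK)
    · exact ⟨z₁ * t, Kz.mul_mem hz₁Kz htKz, h1, hv1⟩
  -- the perturbations `wᵢ = (i+1)·w₀`
  set w : Fin 3 → Ω := fun i => ((i.val + 1 : ℕ) : Ω) * w₀ with hw
  have hwKz : ∀ i, w i ∈ Kz := fun i => Kz.mul_mem (natCast_mem Kz _) hw₀Kz
  have hwval : ∀ i, V.valuation (w i) < V.valuation x := fun i => by
    rw [hw, map_mul]
    calc V.valuation ((i.val + 1 : ℕ) : Ω) * V.valuation w₀ ≤ 1 * V.valuation w₀ :=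
          mul_le_mul' ((V.valuation_le_one_iff _).mpr (natCast_mem V _)) le_rfl
      _ = V.valuation w₀ := one_mul _
      _ < V.valuation x := hw₀val
  obtain ⟨i, -, hiQ⟩ := exists_good_index (P := fun _ => False) (Q := fun u => IsAlgebraic K u)
    (fun u v hu _ => hu) (fun u v hu hv => hu.sub hv) x w (fun i j hij => by
      refine ⟨not_false, fun halgK => ?_⟩
      have hc : w i - w j = (((i.val + 1 : ℕ) : Ω) - ((j.val + 1 : ℕ) : Ω)) * w₀ := by
        rw [hw, sub_mul]
      have hc0 : ((i.val + 1 : ℕ) : Ω) - ((j.val + 1 : ℕ) : Ω) ≠ 0 := fun h0 => by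
        have := Nat.cast_injective (R := Ω) (sub_eq_zero.mp h0)
        exact hij (Fin.ext (by omega))
      have hcK : ((i.val + 1 : ℕ) : Ω) - ((j.val + 1 : ℕ) : Ω) ∈ K :=
        K.sub_mem (natCast_mem K _) (natCast_mem K _)
      refine transcendental_of_mem_closure K hz (Kz.sub_mem (hwKz i) (hwKz j)) (fun hK => hw₀K ?_) halgK
      have : w₀ = (((i.val + 1 : ℕ) : Ω) - ((j.val + 1 : ℕ) : Ω))⁻¹ * (w i - w j) := by
        rw [hc, ← mul_assoc, inv_mul_cancel₀ hc0, one_mul]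
      exact this ▸ K.mul_mem (K.inv_mem hcK) hK)
  have hyF : x + w i ∈ F := F.add_mem hxF (hKzF (hwKz i))
  have hyt : Transcendental K (x + w i) := hiQ
  refine ⟨x + w i, hyF, fun b hb => ?_, ?_⟩
  · -- `b` is algebraic over the perfect field `K(y)`, hence separable
    set E : Subfield Ω := Subfield.closure ((K : Set Ω) ∪ {x + w i}) with hE
    have hbE : IsAlgebraic E b := isAlgebraic_closure_of_transcendental halg hyF hyt b hb
    haveI : CharZero E := (algebraMap E Ω).charZero
    exact PerfectField.separable_of_irreducible (minpoly.irreducible hbE.isIntegral)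
  · rw [add_sub_cancel_left]
    exact hwval i

end Perturb

/-! ### The discharge -/

/-- **Kuhlmann 2019, Lemma 5.4** — discharge of the named fact `Kuhlmann2019_Lemma54`
(`Kuhlmann2019HenselianRationalitySteps.lean`): "Let `F|K` be a separable function field of
transcendence degree 1 and `Q` a nontrivial place on `F`. Then for every `x ∈ F^×` there exists
a separating element `y` of `F|K` which satisfies `v_Q(y) = v_Q(x)` and if `v_Q(x) = 0`, also
`yQ = xQ`." PROVED: a separating element `z ∈ F` exists
(`exists_separating_of_separablyGeneratedOver`); by the perturbation argument
(`exists_separating_valuation_sub_lt_charP` / `…_charZero`) there is a separating `y ∈ F` with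
`v(y - x) < v(x)`, whence `v(y) = v(x)` and, if `v(x) = 0` (multiplicatively `= 1`),
`v(y - x) < 1`, i.e. `yQ = xQ`. [cite: Kuhlmann2019, Lemma 5.4] -/
theorem Kuhlmann2019_Lemma54_holds : Kuhlmann2019_Lemma54.{u} := by
  intro Ω _ V K F hKF hfg hsep h1 hnt x hxF hx0
  classical
  obtain ⟨z, hzF, hz, hsepz⟩ := exists_separating_of_separablyGeneratedOver hsep h1
  have halg : ∀ b ∈ F, IsAlgebraic (Subfield.closure ((K : Set Ω) ∪ {z})) b := fun b hb =>
    (hsepz b hb).isIntegral.isAlgebraic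
  obtain ⟨y, hyF, hysep, hyx⟩ : ∃ y ∈ F,
      (∀ w ∈ F, IsSeparable (Subfield.closure ((K : Set Ω) ∪ {y})) w) ∧
        V.valuation (y - x) < V.valuation x := by
    obtain h0 | ⟨p, hp, hpΩ⟩ := CharP.exists' Ω
    · exact exists_separating_valuation_sub_lt_charZero V hKF hzF hz halg hnt hxF hx0
    · haveI := hp
      exact exists_separating_valuation_sub_lt_charP V p hKF hfg hzF hz hsepz hnt hxF hx0
  refine ⟨y, hyF, fun w hw => (isSeparable_closure_iff K {y} w).mp (hysep w hw), ?_, fun hx1 => ?_⟩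
  · have : y = x + (y - x) := by ring
    rw [this]
    exact Valuation.map_add_eq_of_lt_left _ hyx
  · rwa [hx1] at hyx

end Literature.AlgebraicGeometry.Resolution
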